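import Literature.AlgebraicGeometry.HodgeTheory.AlgebraicClassesHodgeTypeHolds
import HarnessLib

/-!
# Line `core-splitting-ladder` (crux `AlgebraicOrEnveloped`, stmt-HodgeConjecture-14943) — stub `stub_algebraicClassesHodge` (rev 6), CLOSED

The registered Stub 1a of the skeleton `Cruxes/AlgebraicOrEnveloped/Lines/core_splitting_ladder.lean` (rev 6): algebraic classes
of codimension `k` on a smooth projective complex variety are of Hodge type `(k,k)` (Voisin I Prop. 11.20) — the PURE case of
Grothendieck's coniveau remark, which is all the line consumes (p118246). It is now a THEOREM of the tree:
`isOfHodgeType_of_mem_algebraicClasses_of_isSmoothProjective` (`AlgebraicClassesHodgeTypeHolds`, p118251, seat 14299-c2: Wirtinger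
non-vanishing of fundamental classes p117164, projective resolutions, purity of the Gysin kernel). With it the skeleton is down to
two sorries: `CupProductAlgebraic` (route item stmt-HodgeConjecture-14350) and the bet (HC on Hecke cores).
-/

noncomputable section
set_option linter.dupNamespace false -- `Summit.<P>.<Sub>.Theorems.…` repeats `HodgeConjecture` (single-conjunct summit)

namespace Summit.HodgeConjecture.HodgeConjecture.Theorems.CoreSplittingLadder

open Literature.AlgebraicGeometry.Motives (SchemeOver IsSmoothProjective)
open Literature.AlgebraicGeometry.HodgeTheory

/-- **Algebraic classes are Hodge classes** (Voisin I Prop. 11.20) — the registered `stub_algebraicClassesHodge` of line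
`core-splitting-ladder`, by the tree's unconditional `isOfHodgeType_of_mem_algebraicClasses_of_isSmoothProjective` (p118251).
[cite: VoisinHodgeI2002, §11.1.2 Prop. 11.20] -/
theorem stub_algebraicClassesHodge :
    ∀ ⦃d : ℕ⦄ ⦃Y : SchemeOver ℂ⦄, IsSmoothProjective d Y →
      ∀ (k : ℕ) (x : complexBetti Y (2 * k)), x ∈ algebraicClasses Y k → IsOfHodgeType d Y (2 * k) k k x :=
  fun _ _ hY k _ hx ↦ isOfHodgeType_of_mem_algebraicClasses_of_isSmoothProjective hY k hx

end Summit.HodgeConjecture.HodgeConjecture.Theorems.CoreSplittingLadder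

end
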